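import Literature.Computability.AlgebraicComplexity.BorderRankKronecker
import HarnessLib

/-!
# `R̃(t) ≤ bR(t)`: the asymptotic rank is at most the border rank — proved

Topic `Literature/Computability/AlgebraicComplexity`. A short complement to `BorderRankKronecker.lean`
(`R_h(t) ≤ r ⇒ R(t^{⊗N}) ≤ C(Nh+2, 2) · r^N`, `tensorRank_kroneckerPow_le_of_approxRank_le`, from
Bläser 2013, Thm. 6.3(3) and Lemma 6.4) in terms of the asymptotic rank
`asymptoticRank t = R̃(t) = inf_N R(t^{⊗N})^{1/N}` of `AsymptoticSpectrum.lean`: for finite index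
types and every commutative semiring,

* `asymptoticRank_le_approxRank` — `R̃(t) ≤ R_h(t)` for every order `h`;
* `asymptoticRank_le_algBorderRank` — **`R̃(t) ≤ bR(t)`** (Bürgisser–Clausen–Shokrollahi 1997,
  Lemma (15.27): "`limsup_N N⁻¹ log R(φ^{⊗N}) ≤ log bR(φ)`", Ex. 15.24(2): "`R̃(t) ≤ bR(t) ≤ R(t)`";
  Bläser 2013, proof of Thm. 6.6: the correction factor is `poly(N)^{1/N} → 1`).

Proof: if `r = R_h(t) < R̃(t) =: A` then `a := A/r > 1` and `A^N ≤ R(t^{⊗N}) ≤ (h+2)² N² r^N`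
give `a^N ≤ (h+2)² N²` for all `N ≥ 1`, contradicting `N² = o(a^N)`. Used for the Coppersmith–
Winograd tensor (`BigCoppersmithWinogradProofs.lean`: `R̃(CW_q) ≤ bR(CW_q) ≤ q + 2`).

## References

* P. Bürgisser, M. Clausen, M. A. Shokrollahi, *Algebraic Complexity Theory*, Springer 1997, §15.4,
  Lemma (15.27); Ex. 15.24(2). [BurgisserClausenShokrollahi1997]
* M. Bläser, *Fast Matrix Multiplication*, Theory of Computing Graduate Surveys 5 (2013), §6,
  proof of Thm. 6.6 (p. 28). [Blaser2013]
-/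

noncomputable section

open Filter Topology

namespace Literature.Computability.AlgebraicComplexity

universe u

variable {K : Type u} [CommSemiring K] {ι κ μ : Type*}

/-- **`R̃(t) ≤ R_h(t)`** for every order `h` (finite index types): `R̃(t)^N ≤ R(t^{⊗N}) ≤
C(Nh+2,2) R_h(t)^N ≤ (h+2)² N² R_h(t)^N` for all `N ≥ 1`, and `N² = o(aᴺ)` for every `a > 1`
(BCS 1997, proof of Lemma (15.27); Bläser 2013, proof of Thm. 6.6).
[cite: BurgisserClausenShokrollahi1997, Lemma (15.27)] -/
theorem asymptoticRank_le_approxRank [Fintype ι] [Fintype κ] [Fintype μ] [DecidableEq ι]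
    [DecidableEq κ] [DecidableEq μ] (h : ℕ) (t : ι → κ → μ → K) :
    asymptoticRank t ≤ approxRank h t := by
  set r := approxRank h t with hr
  set A := asymptoticRank t with hAdef
  have hA0 : 0 ≤ A := asymptoticRank_nonneg t
  have hbdd : BddBelow (Set.range fun N : ℕ =>
      ((tensorRank (kroneckerPow t (N + 1)) : ℝ) ^ ((N : ℝ) + 1)⁻¹)) :=
    ⟨0, by rintro _ ⟨N, rfl⟩; positivity⟩
  -- `A^(N+1) ≤ R(t^{⊗(N+1)}) ≤ (h+2)^2 (N+1)^2 r^(N+1)`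
  have hApow : ∀ N : ℕ, A ^ (N + 1) ≤ ((h : ℝ) + 2) ^ 2 * ((N : ℝ) + 1) ^ 2 * (r : ℝ) ^ (N + 1) := by
    intro N
    have h1 : A ≤ ((tensorRank (kroneckerPow t (N + 1)) : ℝ) ^ ((N : ℝ) + 1)⁻¹) := ciInf_le hbdd N
    have h2 := tensorRank_kroneckerPow_le_of_approxRank_le (le_refl (approxRank h t)) (N + 1)
    have h3 := choose_mul_add_two_le (h := h) (Nat.succ_pos N)
    have h4 : (N : ℝ) + 1 = ((N + 1 : ℕ) : ℝ) := by push_cast; ring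
    calc A ^ (N + 1) ≤ (((tensorRank (kroneckerPow t (N + 1)) : ℝ) ^ ((N : ℝ) + 1)⁻¹)) ^ (N + 1) :=
          pow_le_pow_left₀ hA0 h1 _
      _ = tensorRank (kroneckerPow t (N + 1)) := by
          rw [h4, Real.rpow_inv_natCast_pow (Nat.cast_nonneg _) (Nat.succ_ne_zero N)]
      _ ≤ (((N + 1) * h + 2).choose 2 * r ^ (N + 1) : ℕ) := by exact_mod_cast h2
      _ ≤ ((h + 2) ^ 2 * (N + 1) ^ 2 * r ^ (N + 1) : ℕ) := by exact_mod_cast Nat.mul_le_mul_right _ h3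
      _ = ((h : ℝ) + 2) ^ 2 * ((N : ℝ) + 1) ^ 2 * (r : ℝ) ^ (N + 1) := by push_cast; ring
  by_contra hlt
  rw [not_le] at hlt
  rcases Nat.eq_zero_or_pos r with hr0 | hrpos
  · -- `r = 0`: then `R(t^{⊗1}) = 0` and `A ≤ 0`
    have h1 := hApow 0
    rw [hr0] at h1 hlt
    simp only [Nat.cast_zero, zero_add, pow_one, mul_zero] at h1 hlt
    exact absurd h1 (not_le.2 hlt)
  · have hr0 : (0 : ℝ) < r := by exact_mod_cast hrpos
    set a : ℝ := A / r with ha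
    have ha1 : 1 < a := (one_lt_div hr0).2 hlt
    have ha0 : 0 < a := zero_lt_one.trans ha1
    have hAa : A = a * r := by rw [ha, div_mul_cancel₀ _ hr0.ne']
    -- `a^(N+1) ≤ (h+2)^2 (N+1)^2`
    have hpow' : ∀ N : ℕ, a ^ (N + 1) ≤ ((h : ℝ) + 2) ^ 2 * ((N : ℝ) + 1) ^ 2 := by
      intro N
      have h1 := hApow N
      rw [hAa, mul_pow] at h1
      exact le_of_mul_le_mul_right h1 (pow_pos hr0 _)
    -- but `(N+1)^2 / a^(N+1) → 0`
    have hlim : Tendsto (fun N : ℕ => (((N + 1 : ℕ) : ℝ)) ^ 2 / a ^ (N + 1)) atTop (𝓝 0) :=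
      (tendsto_pow_const_div_const_pow_of_one_lt 2 ha1).comp (tendsto_add_atTop_nat 1)
    have hsmall : (0 : ℝ) < 1 / (((h : ℝ) + 2) ^ 2 + 1) := by positivity
    obtain ⟨N, hN⟩ := (hlim.eventually (gt_mem_nhds hsmall)).exists
    have haN : 0 < a ^ (N + 1) := pow_pos ha0 _
    rw [div_lt_div_iff₀ haN (by positivity), one_mul] at hN
    push_cast at hN
    have h2 := hpow' N
    nlinarith [h2, hN, sq_nonneg ((N : ℝ) + 1), haN]

/-- **`R̃(t) ≤ bR(t)`**: the asymptotic rank is at most the algebraic border rank (finite index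
types, any commutative semiring; BCS 1997, Lemma (15.27) and Ex. 15.24(2); Bläser 2013, §6).
[cite: BurgisserClausenShokrollahi1997, Lemma (15.27)] -/
theorem asymptoticRank_le_algBorderRank [Fintype ι] [Fintype κ] [Fintype μ] [DecidableEq ι]
    [DecidableEq κ] [DecidableEq μ] (t : ι → κ → μ → K) :
    asymptoticRank t ≤ algBorderRank t := by
  obtain ⟨h, hh⟩ := exists_algBorderRank_eq_approxRank t
  rw [hh]
  exact_mod_cast asymptoticRank_le_approxRank h t

/-- `R̃(t) ≤ r` from any border rank bound `bR(t) ≤ r`. [cite: BurgisserClausenShokrollahi1997, Lemma (15.27)] -/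
theorem asymptoticRank_le_of_algBorderRank_le [Fintype ι] [Fintype κ] [Fintype μ] [DecidableEq ι]
    [DecidableEq κ] [DecidableEq μ] {t : ι → κ → μ → K} {r : ℕ} (ht : algBorderRank t ≤ r) :
    asymptoticRank t ≤ r :=
  (asymptoticRank_le_algBorderRank t).trans (by exact_mod_cast ht)

end Literature.Computability.AlgebraicComplexity

end
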